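import Summits.QuantumFields.BalabanUV.Beta.D1BFx.TorusWeightWordTwisted
import Summits.QuantumFields.BalabanUV.Beta.D1BFx.PackedSortedBridges
import Summits.QuantumFields.BalabanUV.Beta.D1BFx.PackedTowerSlots

/-!
# `BalabanUV.Beta.D1BFx.PackedCoframeWord` — road «BF-x» for binder row D1, slot (K), chain step (I) «(A1)-PACKED», brick «COFRAME-ARRAYS»
# (TB4-W PART 3 at response-packed jets), FILE C «COFRAME-PACK-1»: **THE TWISTED FIRST CO-FRAME WEIGHT JET AT RESPONSE-PACKED TB4-W JETS IS THE
# SORTED PERIODISED ARRAY OF ONE p-FREE PACKED `ℤ⁴` FAMILY** — for bond-indexed p-free weights `w` decaying from `P`, responses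
# `r i = Σ'_t w κ′_i (ŵ_i + s·t)` ((B6′)'s `hrₛ`), and TB4-W's jets packed by them (`Tₛ = Σ_i r i • Tjet₁ s (e₁ i) N̂ e₁`, `Aₛ = Σ_i r i • Ajet₁ s (e₁ i) N̂`):
# `fromBlocks (tgram₁ T₀ Tₛ A₀ Aₛ) 0 0 0 = blocksHat p (sortK (m+1) (arr s (embFF (Σ_κ wsum (w κ) (tBw₁ (m+1) a κ)))))` — EXACTLY the shape of the
# co-frame summand of PART 3b's (A2-N) letter `hJN : tj₂ (kₛ + tgram₁ T₀ Tₛ A₀ Aₛ) qₛ = (arr s (𝒱N k μ 0))ˆˢ`; the packed family is p-FREE, bi-localised at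
# `(P, P)` ((u1)) — hence (u2) is `tendsto_const_nhds` — and at the road's weights `colH G₀ (m+1) μ y` it IS a chain-rule vertex
# `vertexOfK G₀ (m+1) (embFF ∘ tBw₁ (m+1) a) μ y` (Q-DICT-N: the twisted-Gram family `𝒢₁` is k-INDEPENDENT and of `vertexOfK` form)

HONEST DEPENDENCY (cell records, verbatim): «continuum YM on T⁴ ⇐ BetaPertH ∧ nine spine estimates (0/9 proved); BetaPertH ⇐ (D1) ∧ (D4) ∧
CAP+tail; G-an2-4 gates asym, D1 and NE2/3/4.»  HONEST FRAMING (cell contract, verbatim): «discharging `BetaPertH` makes Bałaban's UV stability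
UNCONDITIONAL — a real constructive-QFT result; it is NOT the continuum limit and NOT the Clay problem.»  THIS MODULE DISCHARGES NOTHING of (K),
of D1 or of the wall: [folklore] composition BY NAME of FILE A `TorusWeightWordTwisted` (`tgram₁_Tjet_Nhat_eq_hat_submatrix`, `biLoc_tBw₁`,
`tBw₁_imageShift`), leaf-03 g22's FILE 1 `PeriodicArrayPackingPlain` (`periodiseF_toF_arr_dirsum_wsum`, `biLoc_dirsum_wsum` at the bond fibre `Fin 4`),
the owner's «SLOT-PACK» `PackedSlotMultilinear.tgram₁_packed`, FILE 0 `PackedSortedBridges` (`blocksHat_sortK_arr_embFF`, `biLoc_embFF`) and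
`PackedTowerSlots.e₁_eq_siteOf ∕ submatrix_sum_smul`.  No `def`, no `def … : Prop`, nothing cited, 0 sorry.  0∕4 binders of row D1; (K) NOT closed;
NOT D1, NOT BetaPertH, NOT continuum, NOT Clay.

ABSOLUTE RULE (cell charter, verbatim): «No internally-minted statement may enter as a cited fact. Every hypothesis is either kernel-proved in this
package or a verbatim quotation of a PUBLISHED theorem with page reference. The manuscript(s) under audit are NOT citable for their own disputed
steps — they are the thing under adjudication; programme-internal (2001/route/tribunal) claims are never citable.»

CONTENT (`s = (m+1)·p`, `N̂ = Nhat r (m+1) p`, `r ∈ box 4 (m+1)`, `0 < a`; weights `|w κ u| ≤ C·e^{−δ|u−P|₁}`, `0 < δ ≤ dB (m+1) a ∕ 8`):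
* §1 `biLoc_tBw₁_rate` (FILE A's localisation at any smaller rate), **`sum_smul_tgram₁_eq_hat_submatrix`**
  (`Σ_i r i • tgram₁ T₀ (Tjet₁ (e₁ i)) A₀ (Ajet₁ (e₁ i)) = ((toF (arr s 𝒱cof))^).submatrix e₁ e₁`, `𝒱cof := Σ_κ wsum (w κ) (tBw₁ (m+1) a κ)`),
  **`tgram₁_packed_eq_hat_submatrix`** (the same with the packed jets `Tₛ`, `Aₛ` — `tgram₁_packed`).
* §2 **`biLoc_cofWord`** ((u1) at `(P,P)`, rate `δ∕2`), **`tgram₁_packed_eq_blocksHat`** (the sorted `fromBlocks … 0 0 0` form through `embFF`),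
  `vertexOfK_embFF` (`vertexOfK K N (embFF ∘ S) = embFF (Σ_κ wsum (colH K N μ y κ) (S κ))` — the packed family at the road's weights is a chain-rule vertex).
Unit `b2b-balaban-beta-d1-formalise-leaf-03` (gen 23); road owner `b2b-balaban-beta-d1-p2` (`OWNER-MEMO-g17.md` §2 item (2), Q-DICT-N l.40409).
-/

noncomputable section

namespace Summit.QuantumFields.BalabanUV.Beta.D1BFx.PackedCoframeWord

open Matrix
open scoped BigOperators
open Literature.Probability.LatticeModels (TorusSite)
open Literature.MathematicalPhysics.QuantumFieldTheory.Balaban1983to89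
open Literature.MathematicalPhysics.QuantumFieldTheory.Balaban1983to89.Beta
open B12Sec2to5 (l1 l1_nonneg)
open ExpKernelCalculus (MKer BiLoc Zl)
open AffineAveraging (box toSite)
open OneStepResolventKernel (Fib wsum)
open OneStepKernelFamily (colH vertexOfK)
open Summit.QuantumFields.BalabanUV.Beta.D1BFx.FibredPeriodisation (periodiseF)
open Summit.QuantumFields.BalabanUV.Beta.D1BFx.SortedKernels (blocksHat)
open Summit.QuantumFields.BalabanUV.Beta.D1BFx.SortedPack (sortK)
open Summit.QuantumFields.BalabanUV.Beta.D1BFx.SortedReblocking (torusBlockEquiv)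
open Summit.QuantumFields.BalabanUV.Beta.D1BFx.SortedEmbedding (e₁)
open Summit.QuantumFields.BalabanUV.Beta.D1BFx.PeriodicArrays (arr toF)
open Summit.QuantumFields.BalabanUV.Beta.D1BFx.GramWeightColourLift (tgram₁)
open Summit.QuantumFields.BalabanUV.Beta.D1BFx.TorusCombKKT (I CombRows)
open Summit.QuantumFields.BalabanUV.Beta.D1BFx.TorusGaugeBasisMatrix (Nhat)
open Summit.QuantumFields.BalabanUV.Beta.D1BFx.TorusCoframeJets (Tjet₀ Tjet₁ Ajet₀ Ajet₁)
open Summit.QuantumFields.BalabanUV.Beta.D1BFx.TorusBondArrays (dB dB_pos)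
open Summit.QuantumFields.BalabanUV.Beta.D1BFx.PackedSlotMultilinear (tgram₁_packed)
open Summit.QuantumFields.BalabanUV.Beta.D1BFx.PeriodicArrayPackingPlain (periodiseF_toF_arr_dirsum_wsum biLoc_dirsum_wsum)
open Summit.QuantumFields.BalabanUV.Beta.D1BFx.PackedTowerSlots (e₁_eq_siteOf submatrix_sum_smul)
open Summit.QuantumFields.BalabanUV.Beta.D1BFx.PackedSortedBridges (embFF embFF_inl_inl embFF_inl_inr embFF_inr_inl embFF_inr_inr biLoc_embFF
  blocksHat_sortK_arr_embFF)
open Summit.QuantumFields.BalabanUV.Beta.D1BFx.TorusWeightWordTwisted (tBw₁ biLoc_tBw₁ tBw₁_imageShift tgram₁_Tjet_Nhat_eq_hat_submatrix)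

/-! ## §1 The response-packed twisted first weight jet -/

section Packing

variable (m : ℕ) {a : ℝ} (p : ℕ) [NeZero p] {r : Fin 4 → ℕ} {w : Fin 4 → (Fin 4 → ℤ) → ℝ} {C δ : ℝ} {P : Fin 4 → ℤ} {rS : I 3 (m + 1) p → ℝ}

/-- [folklore] FILE A's localisation of `tBw₁` at any smaller rate `δ ≤ dB/8` (same constant). -/
theorem biLoc_tBw₁_rate (ha : 0 < a) (hδB : δ ≤ dB (m + 1) a / 8) :
    ∃ Cs : ℝ, 0 ≤ Cs ∧ ∀ (κ : Fin 4) (u : Fin 4 → ℤ), BiLoc (tBw₁ (m + 1) a κ u) u u Cs δ := by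
  obtain ⟨Cs, h0, h⟩ := biLoc_tBw₁ m ha
  exact ⟨Cs, h0, fun κ u => StepJetData.biLoc_weaken (h κ u) le_rfl hδB⟩

/-- [folklore] **THE RESPONSE-WEIGHTED SUM OF THE PER-BOND TWISTED WEIGHT JETS IS ONE PERIODISED ARRAY**: for p-free weights `w` decaying from `P`
at a rate `0 < δ ≤ dB/8` and responses `rS i = Σ'_t w κ′_i (ŵ_i + s·t)`,
`Σ_i rS i • tgram₁ (Tjet₀ s N̂ e₁) (Tjet₁ s (e₁ i) N̂ e₁) (Ajet₀ s N̂) (Ajet₁ s (e₁ i) N̂) = ((toF (arr s (Σ_κ wsum (w κ) (tBw₁ (m+1) a κ))))^).submatrix e₁ e₁`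
(FILE A per bond + leaf-03 g22's «PACK-PLAIN» at the bond fibre `Fin 4`, period covariance `tBw₁_imageShift`). -/
theorem sum_smul_tgram₁_eq_hat_submatrix (ha : 0 < a) (hr : r ∈ box (3 + 1) (m + 1))
    (hw : ∀ κ u, |w κ u| ≤ C * Real.exp (-δ * l1 (u - P))) (hδ : 0 < δ) (hδB : δ ≤ dB (m + 1) a / 8)
    (hrS : ∀ i, rS i = ∑' t : Fin 4 → ℤ, w i.2.2 (imageShift ((m + 1) * p) (windowMap 4 ((m + 1) * p) (torusBlockEquiv (m + 1) p (i.1, i.2.1))) t)) :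
    ∑ i : I 3 (m + 1) p, rS i • tgram₁ (Tjet₀ ((m + 1) * p) (Nhat r (m + 1) p) (e₁ (m + 1) p))
        (Tjet₁ ((m + 1) * p) (e₁ (m + 1) p i) (Nhat r (m + 1) p) (e₁ (m + 1) p)) (Ajet₀ ((m + 1) * p) (Nhat r (m + 1) p))
        (Ajet₁ ((m + 1) * p) (e₁ (m + 1) p i) (Nhat r (m + 1) p))
      = (Matrix.of (periodiseF ((m + 1) * p) (toF (arr ((m + 1) * p)
          (fun x y α β => ∑ κ : Fin 4, wsum (w κ) (tBw₁ (m + 1) a κ) x y α β))))).submatrix (e₁ (m + 1) p) (e₁ (m + 1) p) := by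
  obtain ⟨Cs, -, hS⟩ := biLoc_tBw₁_rate m ha hδB
  have hC : 0 ≤ C := PeriodicArrayWrapLimit.const_nonneg_of_weight (hw 0)
  rw [periodiseF_toF_arr_dirsum_wsum (d := 3) hw hS (fun κ u t => tBw₁_imageShift κ u m p ha t) hδ hC, submatrix_sum_smul]
  refine Finset.sum_congr rfl fun i _ => ?_
  rw [hrS i, e₁_eq_siteOf, tgram₁_Tjet_Nhat_eq_hat_submatrix m p _ _ ha hr]

/-- [folklore] **«COFRAME-PACK-1» — THE TWISTED FIRST CO-FRAME WEIGHT JET AT RESPONSE-PACKED TB4-W JETS**: with the packed jets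
`Tₛ = Σ_i rS i • Tjet₁ s (e₁ i) N̂ e₁`, `Aₛ = Σ_i rS i • Ajet₁ s (e₁ i) N̂` ((B6′)'s pins `hTₛ hAₛ`),
`tgram₁ (Tjet₀ s N̂ e₁) Tₛ (Ajet₀ s N̂) Aₛ = ((toF (arr s (Σ_κ wsum (w κ) (tBw₁ (m+1) a κ))))^).submatrix e₁ e₁` (`tgram₁_packed` + §1). -/
theorem tgram₁_packed_eq_hat_submatrix (ha : 0 < a) (hr : r ∈ box (3 + 1) (m + 1))
    (hw : ∀ κ u, |w κ u| ≤ C * Real.exp (-δ * l1 (u - P))) (hδ : 0 < δ) (hδB : δ ≤ dB (m + 1) a / 8)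
    (hrS : ∀ i, rS i = ∑' t : Fin 4 → ℤ, w i.2.2 (imageShift ((m + 1) * p) (windowMap 4 ((m + 1) * p) (torusBlockEquiv (m + 1) p (i.1, i.2.1))) t)) :
    tgram₁ (Tjet₀ ((m + 1) * p) (Nhat r (m + 1) p) (e₁ (m + 1) p))
        (∑ i : I 3 (m + 1) p, rS i • Tjet₁ ((m + 1) * p) (e₁ (m + 1) p i) (Nhat r (m + 1) p) (e₁ (m + 1) p))
        (Ajet₀ ((m + 1) * p) (Nhat r (m + 1) p))
        (∑ i : I 3 (m + 1) p, rS i • Ajet₁ ((m + 1) * p) (e₁ (m + 1) p i) (Nhat r (m + 1) p))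
      = (Matrix.of (periodiseF ((m + 1) * p) (toF (arr ((m + 1) * p)
          (fun x y α β => ∑ κ : Fin 4, wsum (w κ) (tBw₁ (m + 1) a κ) x y α β))))).submatrix (e₁ (m + 1) p) (e₁ (m + 1) p) := by
  rw [tgram₁_packed, sum_smul_tgram₁_eq_hat_submatrix m p ha hr hw hδ hδB hrS]

end Packing

/-! ## §2 Localisation, the sorted currency, and the chain-rule-vertex form -/

section Sorted

variable (m : ℕ) {a : ℝ} (p : ℕ) [NeZero p] {r : Fin 4 → ℕ} {w : Fin 4 → (Fin 4 → ℤ) → ℝ} {C δ : ℝ} {P : Fin 4 → ℤ} {rS : I 3 (m + 1) p → ℝ}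

/-- [folklore] **(u1) — THE PACKED TWISTED WEIGHT FAMILY IS BI-LOCALISED AT THE WEIGHTS' CENTRE**, embedded or not: for `|w κ u| ≤ C·e^{−δ|u−P|₁}`,
`0 < δ ≤ dB/8`, there is `C′ ≥ 0` (depending on `C, δ, m, a` only — NOT on `P`, NOT on any period) with
`BiLoc (embFF (Σ_κ wsum (w κ) (tBw₁ (m+1) a κ))) P P C′ (δ∕2)`. -/
theorem biLoc_cofWord (ha : 0 < a) (hw : ∀ κ u, |w κ u| ≤ C * Real.exp (-δ * l1 (u - P))) (hδ : 0 < δ) (hδB : δ ≤ dB (m + 1) a / 8) :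
    ∃ C' : ℝ, 0 ≤ C' ∧ BiLoc (embFF (fun x y α β => ∑ κ : Fin 4, wsum (w κ) (tBw₁ (m + 1) a κ) x y α β)) P P C' (δ / 2) := by
  obtain ⟨Cs, hCs, hS⟩ := biLoc_tBw₁_rate m ha hδB
  have hC : 0 ≤ C := PeriodicArrayWrapLimit.const_nonneg_of_weight (hw 0)
  refine ⟨∑ _κ : Fin 4, C * Cs * Zl (3 + 1) (δ / 2), Finset.sum_nonneg fun _ _ => ?_, biLoc_embFF _ (biLoc_dirsum_wsum (d := 3) hw hS hδ hC)⟩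
  exact mul_nonneg (mul_nonneg hC hCs) (ExpKernelCalculus.Zl_pos (half_pos hδ)).le

/-- [folklore] The same localisation with an EXPLICIT constant that does not depend on the centre `P` (so that ONE constant serves the whole
k-indexed family of (B6′)): `∃ C′, ∀ P w, (|w κ u| ≤ C·e^{−δ|u−P|₁}) → BiLoc (embFF (Σ_κ wsum (w κ) (tBw₁ …))) P P C′ (δ∕2)`. -/
theorem biLoc_cofWord_uniform (ha : 0 < a) (hC : 0 ≤ C) (hδ : 0 < δ) (hδB : δ ≤ dB (m + 1) a / 8) :
    ∃ C' : ℝ, 0 ≤ C' ∧ ∀ (P : Fin 4 → ℤ) (w : Fin 4 → (Fin 4 → ℤ) → ℝ), (∀ κ u, |w κ u| ≤ C * Real.exp (-δ * l1 (u - P))) →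
      BiLoc (embFF (fun x y α β => ∑ κ : Fin 4, wsum (w κ) (tBw₁ (m + 1) a κ) x y α β)) P P C' (δ / 2) := by
  obtain ⟨Cs, hCs, hS⟩ := biLoc_tBw₁_rate m ha hδB
  refine ⟨∑ _κ : Fin 4, C * Cs * Zl (3 + 1) (δ / 2), Finset.sum_nonneg fun _ _ => ?_, fun P w hw =>
    biLoc_embFF _ (biLoc_dirsum_wsum (d := 3) hw hS hδ hC)⟩
  exact mul_nonneg (mul_nonneg hC hCs) (ExpKernelCalculus.Zl_pos (half_pos hδ)).le

/-- [folklore] **«COFRAME-PACK-1» IN THE SORTED `(I ⊕ J)` CURRENCY OF PART 3b's `hJN` LETTER**: with the packed jets `Tₛ`, `Aₛ` as above,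
`fromBlocks (tgram₁ (Tjet₀ s N̂ e₁) Tₛ (Ajet₀ s N̂) Aₛ) 0 0 0 = blocksHat p (sortK (m+1) (arr s (embFF (Σ_κ wsum (w κ) (tBw₁ (m+1) a κ)))))`
(§1 + FILE 0 `blocksHat_sortK_arr_embFF`). -/
theorem tgram₁_packed_eq_blocksHat (ha : 0 < a) (hr : r ∈ box (3 + 1) (m + 1))
    (hw : ∀ κ u, |w κ u| ≤ C * Real.exp (-δ * l1 (u - P))) (hδ : 0 < δ) (hδB : δ ≤ dB (m + 1) a / 8)
    (hrS : ∀ i, rS i = ∑' t : Fin 4 → ℤ, w i.2.2 (imageShift ((m + 1) * p) (windowMap 4 ((m + 1) * p) (torusBlockEquiv (m + 1) p (i.1, i.2.1))) t)) :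
    Matrix.fromBlocks
        (tgram₁ (Tjet₀ ((m + 1) * p) (Nhat r (m + 1) p) (e₁ (m + 1) p))
          (∑ i : I 3 (m + 1) p, rS i • Tjet₁ ((m + 1) * p) (e₁ (m + 1) p i) (Nhat r (m + 1) p) (e₁ (m + 1) p))
          (Ajet₀ ((m + 1) * p) (Nhat r (m + 1) p))
          (∑ i : I 3 (m + 1) p, rS i • Ajet₁ ((m + 1) * p) (e₁ (m + 1) p i) (Nhat r (m + 1) p)))
        0 0 (0 : Matrix (TorusCombKKT.J 3 p) (TorusCombKKT.J 3 p) ℝ)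
      = blocksHat p (sortK (m + 1) (arr ((m + 1) * p) (embFF (fun x y α β => ∑ κ : Fin 4, wsum (w κ) (tBw₁ (m + 1) a κ) x y α β)))) := by
  obtain ⟨Cs, -, hS⟩ := biLoc_tBw₁_rate m ha hδB
  have hC : 0 ≤ C := PeriodicArrayWrapLimit.const_nonneg_of_weight (hw 0)
  rw [blocksHat_sortK_arr_embFF (m + 1) p (biLoc_dirsum_wsum (d := 3) hw hS hδ hC) (half_pos hδ),
    tgram₁_packed_eq_hat_submatrix m p ha hr hw hδ hδB hrS]

/-- [folklore] **THE PACKED FAMILY AT `colH`-WEIGHTS IS A CHAIN-RULE VERTEX**: for any packed resolvent `K`, block side `N` and bond stencil family `S`,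
`vertexOfK K N (fun κ u => embFF (S κ u)) μ y = embFF (Σ_κ wsum (colH K N μ y κ) (S κ))` — so the co-frame family of §2 at the road's weights
`w := colH G₀ (m+1) μ y` is `vertexOfK G₀ (m+1) (embFF ∘ tBw₁ (m+1) a) μ y`, k-independent (Q-DICT-N's `𝒢₁`). -/
theorem vertexOfK_embFF {d : ℕ} (K : MKer (d + 1) (Fib d)) (N : ℕ) (S : Fin (d + 1) → (Fin (d + 1) → ℤ) → MKer (d + 1) (Fin (d + 1)))
    (μ : Fin (d + 1)) (y : Fin (d + 1) → ℤ) :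
    vertexOfK K N (fun κ u => embFF (S κ u)) μ y = embFF (fun x z α β => ∑ κ : Fin (d + 1), wsum (colH K N μ y κ) (S κ) x z α β) := by
  funext x z a b
  rcases a with α | α <;> rcases b with β | β
  · rfl
  · show (∑ κ : Fin (d + 1), ∑' u : Fin (d + 1) → ℤ, colH K N μ y κ u * (0 : ℝ)) = 0
    simp only [mul_zero, tsum_zero, Finset.sum_const_zero]
  · show (∑ κ : Fin (d + 1), ∑' u : Fin (d + 1) → ℤ, colH K N μ y κ u * (0 : ℝ)) = 0
    simp only [mul_zero, tsum_zero, Finset.sum_const_zero]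
  · show (∑ κ : Fin (d + 1), ∑' u : Fin (d + 1) → ℤ, colH K N μ y κ u * (0 : ℝ)) = 0
    simp only [mul_zero, tsum_zero, Finset.sum_const_zero]

end Sorted

end Summit.QuantumFields.BalabanUV.Beta.D1BFx.PackedCoframeWord

end
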